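import Literature.AnabelianGeometry.EtaleTheta.ThetaFrobenioid
import Literature.AnabelianGeometry.EtaleTheta.TemperedFrobenioidToyGenuine
import Literature.AnabelianGeometry.EtaleTheta.Discharge.Sec3RatFnMonoidOn
import Literature.AnabelianGeometry.EtaleTheta.Discharge.Sec3Thm37Units
import Literature.AnabelianGeometry.SemiGraphs.CosetCategoriesSlimTempered
import Literature.AnabelianGeometry.SemiGraphs.TemperedAnabelianTowerWitness
import Literature.AlgebraicGeometry.Frobenioids.FSMIMorphisms
import Literature.AlgebraicGeometry.Frobenioids.QuasiTemperoidConnectedPart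
import HarnessLib

/-!
# [EtTh] Def. 3.6 (ii) data restricted along a functor of base categories ([FrdI] Prop. 1.6), and a
# CONSTRUCTED tempered Frobenioid over the genuine base `B^temp(Π)⁰` (non-vacuity of the «OfConnectedTemperoid» files)

S. Mochizuki, *The étale theta function …*, Publ. RIMS **45** (2009) [MochizukiEtTh2009], Def. 3.6 (ii), printed
pp. 302–303 (PDF pp. 76–77): «Let `D` be a connected, totally epimorphic category, equipped with a functor `D → D₀` …
`Φ ⊆ Φ^{ℝ-log} := Φ₀^ℝ|_D` … Thus, the data `(D, Φ, B, B → Φ^gp)` determines a model Frobenioid»; Example 3.9 (iv)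
p. 311 (PDF p. 85): «`Φ_α^ell := Φ_W^ell|_{D_α}`» (restriction of a subfunctor in monoids along `D_α → D_W`, the
tree's `SubMonoidOn.restrict`); S. Mochizuki, *The geometry of Frobenioids I*, Kyushu J. Math. **62** (2008)
[MochizukiFrdI2008], Prop. 1.6 p. 27: «Let `D′` be a connected, totally epimorphic category; `D′ → D` a functor that
maps FSM-morphisms to FSM-morphisms. Denote by `Φ′` the divisorial monoid obtained by restricting `Φ` to `D′` …».
[cite: MochizukiEtTh2009, Def 3.6 p.302 (PDF p.76)] [cite: MochizukiFrdI2008, Prop. 1.6 p.27]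

abc-iut cell, block C / W6 (seat abc-iut-w6-d048), node EtTh:Thm3.7(iv) — MODEL-CONSTRUCTION file (new path, nothing
frozen is edited; review lane).  PURPOSE.  The cone's [EtTh] §3–§5 files at print's GENUINE base
`D = B^temp(Π^tp_X)⁰ = ConnectedPart (BTemp Π)` (`Discharge/Sec5OfConnectedTemperoid.lean`, `Sec5Thm57OfConnectedTemperoid*`,
`Sec4Thm44OfConnectedTemperoid`, this seat's `Discharge/Sec3Thm37ivGenuineBase.lean` p432030, …) quantify over
`tf : TemperedFrobenioid T (ConnectedPart (BTemp Π)) VD`, a class «not shown inhabited» (their headers); over the FULL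
temperoid `BTemp Π` the class is EMPTY (`TemperedFrobenioid.isEmpty_of_bTemp`, p425482).  Here:

* §1 `SubMonoidOn.restrict_toFunctor` — the restricted subfunctor's monoid on `D′` is `G.op ⋙ Φ` ([FrdI] Prop. 1.6 «`Φ′`»;
  objectwise `(S.restrict G).carrier A = S.carrier (G.op.obj A)` is abc-iut-w6-d061's `SubMonoidOn.restrict_carrier`, p432461);
* §2 **`TemperedFrobenioid.restrict`** — the Def. 3.6 (ii) data `(D′, D′ → D → D₀, Φ|_{D′})` obtained from
  `(D, D → D₀, Φ)` along a functor `G : D′ ⥤ D` from a connected, totally epimorphic `D′` mapping FSM-morphisms to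
  FSM-morphisms (every field of Def. 3.6 (ii) is objectwise except «divisorial monoid on `D`», which restricts by [FrdI]
  Prop. 1.6), at the canonical [FrdI] vocabulary `treeCatVocab`; `restrictOfFSMType` (`D′` of FSM-type: FSM-morphisms
  are isomorphisms, which every functor preserves); `restrictConnectedPart` (`D′ := ConnectedPart (BTemp Π)`,
  connected / totally epimorphic / of FSM-type by [FrdII] Ex. 1.3, `QuasiTemperoidConnectedPart.lean`);
* §3 **non-vacuity at the genuine base**: abc-iut-w5-d164's CONSTRUCTED `Toy.genuineTemperedFrobenioid` (genuine
  vocabularies, `Λ = ℤ`, one-object base) re-based on `ConnectedPart (BTemp Π)` for EVERY topological group `Π` along the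
  constant functor — `Toy.genuineTemperedFrobenioidConnectedPart`, `Toy.nonempty_temperedFrobenioid_connectedPart_bTemp`;
* §4 the residual binders of [EtTh] Thm. 3.7 (iv) at that inhabitant are THEOREMS: `hBinj` (pull-backs of `B₀^Λ`
  injective — identities), `hinj` (`B₀^Λ → (Φ₀^ℝ)^gp` injective: `m ↦ 𝔭^m`, `𝔭 ≠ 1` in the sharp cancellative `ℕ^rlf`),
  hence «`C` is a Frobenioid» and, for `Π` tempered and temp-slim (e.g. `Π = 1`), the CONCLUSION of Thm. 3.7 (iv)
  «`C` is slim» holds for a constructed tempered Frobenioid over a genuine connected-temperoid base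
  (`Toy.isSlim_genuineTemperedFrobenioidConnectedPart`, `…_punit`).

HONEST LABEL: §2 is bookkeeping of Def. 3.6 (ii) / [FrdI] Prop. 1.6 (no statement of [EtTh] is strengthened); §3–§4 are
consistency / instantiation witnesses with DEGENERATE geometry (one prime, all functions constant, base functor
constant) — NOT the tempered Frobenioid of a curve; nothing here bears on [IUTchIII] Cor. 3.12.  Typed ≠ proved.
-/

namespace Literature.AnabelianGeometry.EtaleTheta

open CategoryTheory Opposite Function Literature.AlgebraicGeometry.Frobenioids Literature.AnabelianGeometry.SemiGraphs

universe u₀ v₀ u v u' v' w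

/-! ### §1 The restricted subfunctor in monoids as a monoid on `D′` -/

namespace SubMonoidOn

variable {D : Type u} [Category.{v} D] {D' : Type u'} [Category.{v'} D'] {Ψ : Dᵒᵖ ⥤ CommMonCat.{w}}
  (S : SubMonoidOn Ψ) (G : D' ⥤ D)

/-- The monoid on `D′` of the restricted subfunctor is the restriction `G.op ⋙ Φ` of the monoid on `D`
([FrdI] Prop. 1.6: «the divisorial monoid obtained by restricting `Φ` to `D′`»). [cite: MochizukiFrdI2008, Prop. 1.6 p.27] -/
theorem restrict_toFunctor : (S.restrict G).toFunctor = G.op ⋙ S.toFunctor := rfl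

/-- Pull-backs of `Φ|_{D′}` are pull-backs of `Φ` along the images of arrows. [cite: MochizukiFrdI2008, Prop. 1.6 p.27] -/
theorem pull_restrict_toFunctor {A B : D'} (f : B ⟶ A) :
    Literature.AlgebraicGeometry.Frobenioids.pull (S.restrict G).toFunctor f =
      Literature.AlgebraicGeometry.Frobenioids.pull S.toFunctor (G.map f) := rfl

/-- A monoid on `D` restricts to a monoid on `D′` along a functor mapping FSM-morphisms to FSM-morphisms
([FrdI] Prop. 1.6, standing construction). [cite: MochizukiFrdI2008, Prop. 1.6 p.27] -/
theorem isMonoidOn_restrict_toFunctor (hS : IsMonoidOn S.toFunctor)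
    (hG : ∀ {A B : D'} (f : B ⟶ A), IsFSM f → IsFSM (G.map f)) : IsMonoidOn (S.restrict G).toFunctor :=
  ⟨fun f => hS.isCharInjective (G.map f), fun f hf => hS.bijective_of_isFSM (G.map f) (hG f hf)⟩

end SubMonoidOn

/-! ### §2 Def. 3.6 (ii) data restricted along `G : D′ ⥤ D` -/

namespace TemperedFrobenioid

section Restrict

variable {D₀ : Type u₀} [Category.{v₀} D₀] {V : FrdIMonoidStub.{w}} {T : RealifiedDivisorMonoids (D₀ := D₀) V}
  {D : Type u} [Category.{v} D] {IsRational IsStrictlyRational : (Dᵒᵖ ⥤ CommMonCat.{w}) → Prop}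
  (C : TemperedFrobenioid T D (treeCatVocab D IsRational IsStrictlyRational))
  {D' : Type u'} [Category.{v'} D'] (G : D' ⥤ D)
  (IsRational' IsStrictlyRational' : (D'ᵒᵖ ⥤ CommMonCat.{w}) → Prop)

/-- **Def. 3.6 (ii) data restricted along a functor of base categories** ([FrdI] Prop. 1.6): from
`(D, D → D₀, Φ ⊆ Φ₀^ℝ|_D)` and `G : D′ → D` with `D′` connected, totally epimorphic and `G` mapping FSM-morphisms to
FSM-morphisms, the data `(D′, D′ → D → D₀, Φ|_{D′})`: group-saturation, perf-factoriality, (a) `Φ^{bs-fld}` monoprime and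
(b) `F → (Φ^{bs-fld})^gp` nonzero are objectwise; «divisorial monoid on `D′`» is [FrdI] Prop. 1.6.  The [FrdI] Def. 4.5
predicates of the target vocabulary are free parameters, as in `treeCatVocab`.
[cite: MochizukiEtTh2009, Def 3.6 p.302 (PDF p.76)] -/
def restrict (hc : IsConnected D') (hte : IsTotallyEpimorphic D')
    (hG : ∀ {A B : D'} (f : B ⟶ A), IsFSM f → IsFSM (G.map f)) :
    TemperedFrobenioid T D' (treeCatVocab D' IsRational' IsStrictlyRational') where
  isConnected := hc
  isTotallyEpimorphic := hte
  base := G ⋙ C.base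
  Φ := C.Φ.restrict G
  isGroupSaturated A := C.isGroupSaturated (G.op.obj A)
  isPerfFactorial A := C.isPerfFactorial (G.op.obj A)
  isDivisorialOn :=
    (treeCatVocab_isDivisorialOn D' IsRational' IsStrictlyRational' _).mpr
      ⟨C.Φ.isMonoidOn_restrict_toFunctor G
          ((treeCatVocab_isDivisorialOn D IsRational IsStrictlyRational _).mp C.isDivisorialOn).1 hG,
        fun A => ((treeCatVocab_isDivisorialOn D IsRational IsStrictlyRational _).mp C.isDivisorialOn).2 (G.obj A)⟩
  isMonoprime_bsFld A := C.isMonoprime_bsFld (G.op.obj A)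
  exists_FΛ_div_ne A := C.exists_FΛ_div_ne (G.op.obj A)

/-- The base functor of the restricted data is `D′ → D → D₀`. [cite: MochizukiEtTh2009, Def 3.6 p.302 (PDF p.76)] -/
@[simp] theorem restrict_base (hc : IsConnected D') (hte : IsTotallyEpimorphic D')
    (hG : ∀ {A B : D'} (f : B ⟶ A), IsFSM f → IsFSM (G.map f)) :
    (C.restrict G IsRational' IsStrictlyRational' hc hte hG).base = G ⋙ C.base := rfl

/-- The divisor monoid of the restricted data is `Φ|_{D′}`. [cite: MochizukiEtTh2009, Def 3.6 p.302 (PDF p.76)] -/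
@[simp] theorem restrict_Φ (hc : IsConnected D') (hte : IsTotallyEpimorphic D')
    (hG : ∀ {A B : D'} (f : B ⟶ A), IsFSM f → IsFSM (G.map f)) :
    (C.restrict G IsRational' IsStrictlyRational' hc hte hG).Φ = C.Φ.restrict G := rfl

/-- Restriction does not change the monoid type `Λ`. [cite: MochizukiEtTh2009, Def 3.6 p.302 (PDF p.76)] -/
theorem monoidType_restrict (hc : IsConnected D') (hte : IsTotallyEpimorphic D')
    (hG : ∀ {A B : D'} (f : B ⟶ A), IsFSM f → IsFSM (G.map f)) :
    (C.restrict G IsRational' IsStrictlyRational' hc hte hG).monoidType = C.monoidType := rfl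

/-- **Restriction along ANY functor from a base of FSM-type** (FSM-morphisms of `D′` are isomorphisms, and functors
carry isomorphisms to isomorphisms, which are FSM-morphisms — [FrdI] §0). [cite: MochizukiFrdI2008, Prop. 1.6 p.27] -/
def restrictOfFSMType (hc : IsConnected D') (hte : IsTotallyEpimorphic D') (hD' : IsOfFSMType D') :
    TemperedFrobenioid T D' (treeCatVocab D' IsRational' IsStrictlyRational') :=
  C.restrict G IsRational' IsStrictlyRational' hc hte fun f hf => by
    haveI := hD'.isIso_of_isFSM f hf
    exact IsFSM.of_isIso (G.map f)

/-- `restrictOfFSMType` is `restrict`. [cite: MochizukiFrdI2008, Prop. 1.6 p.27] -/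
theorem restrictOfFSMType_base (hc : IsConnected D') (hte : IsTotallyEpimorphic D') (hD' : IsOfFSMType D') :
    (C.restrictOfFSMType G IsRational' IsStrictlyRational' hc hte hD').base = G ⋙ C.base := rfl

end Restrict

/-! ### §2′ Restriction to the genuine base `B^temp(Π)⁰ = ConnectedPart (BTemp Π)` -/

section ConnectedPartBase

variable {D₀ : Type u₀} [Category.{v₀} D₀] {V : FrdIMonoidStub.{w}} {T : RealifiedDivisorMonoids (D₀ := D₀) V}
  {D : Type u} [Category.{v} D] {IsRational IsStrictlyRational : (Dᵒᵖ ⥤ CommMonCat.{w}) → Prop}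
  (C : TemperedFrobenioid T D (treeCatVocab D IsRational IsStrictlyRational))
  (Γ : Type u') [Group Γ] [TopologicalSpace Γ] (G : ConnectedPart (BTemp Γ) ⥤ D)
  (IsRational' IsStrictlyRational' : ((ConnectedPart (BTemp Γ))ᵒᵖ ⥤ CommMonCat.{w}) → Prop)

/-- **Def. 3.6 (ii) data over the genuine base `B^temp(Π)⁰`** obtained by restriction along any functor
`B^temp(Π)⁰ → D`: `B^temp(Π)⁰` is connected, totally epimorphic and of FSM-type ([FrdII] Ex. 1.3 (i)/(iii)).
[cite: MochizukiEtTh2009, Def 3.6 p.302 (PDF p.76)] -/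
def restrictConnectedPart :
    TemperedFrobenioid T (ConnectedPart (BTemp Γ)) (treeCatVocab (ConnectedPart (BTemp Γ)) IsRational' IsStrictlyRational') :=
  C.restrictOfFSMType G IsRational' IsStrictlyRational' QuasiTemperoid.BTempConnected.connectedPart_isConnected
    QuasiTemperoid.BTempConnected.connectedPart_isTotallyEpimorphic
    QuasiTemperoid.BTempConnected.connectedPart_isOfFSMType

/-- Its base functor is `B^temp(Π)⁰ → D → D₀`. [cite: MochizukiEtTh2009, Def 3.6 p.302 (PDF p.76)] -/
@[simp] theorem restrictConnectedPart_base :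
    (C.restrictConnectedPart Γ G IsRational' IsStrictlyRational').base = G ⋙ C.base := rfl

end ConnectedPartBase

end TemperedFrobenioid

/-! ### §3 A constructed tempered Frobenioid over `B^temp(Π)⁰` for every topological group `Π` -/

namespace Toy

variable (Γ : Type u') [Group Γ] [TopologicalSpace Γ]
  (R S : ((ConnectedPart (BTemp Γ))ᵒᵖ ⥤ CommMonCat.{0}) → Prop)

/-- **The genuine-vocabulary toy tempered Frobenioid re-based on `B^temp(Π)⁰`** (`Λ = ℤ`, `Φ₀ = ℕ`, `B₀ = 𝔭^ℤ`,
one-object `D₀`; base functor the constant functor `B^temp(Π)⁰ → D₀`). Degenerate but GENUINE-vocabulary data.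
[cite: MochizukiEtTh2009, Def 3.6 p.302 (PDF p.76)] -/
noncomputable def genuineTemperedFrobenioidConnectedPart :
    TemperedFrobenioid realifiedGenuine (ConnectedPart (BTemp Γ)) (treeCatVocab (ConnectedPart (BTemp Γ)) R S) :=
  (genuineTemperedFrobenioid (fun _ => True) (fun _ => True)).restrictConnectedPart Γ
    ((Functor.const _).obj (Discrete.mk PUnit.unit)) R S

/-- **Non-vacuity of the class `TemperedFrobenioid _ (ConnectedPart (BTemp Π)) (treeCatVocab …)`** for every
topological group `Π`. [cite: MochizukiEtTh2009, Def 3.6 p.302 (PDF p.76)] -/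
theorem nonempty_temperedFrobenioid_connectedPart_bTemp :
    Nonempty (TemperedFrobenioid realifiedGenuine (ConnectedPart (BTemp Γ))
      (treeCatVocab (ConnectedPart (BTemp Γ)) R S)) :=
  ⟨genuineTemperedFrobenioidConnectedPart Γ R S⟩

/-- Its monoid type is `ℤ`. [cite: MochizukiEtTh2009, Def 3.6 p.302 (PDF p.76)] -/
theorem monoidType_genuineTemperedFrobenioidConnectedPart :
    (genuineTemperedFrobenioidConnectedPart Γ R S).monoidType = MonoidType.Z := rfl

/-! ### §4 The residual binders of Thm. 3.7 (iv) hold at the toy data; «`C` is a Frobenioid»; «`C` is slim» -/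

/-- **`hBinj` at the toy Def. 3.3 (iii) data**: pull-backs of `B₀^Λ = B₀` along the arrows of the one-object base
(identities) are injective. [cite: MochizukiEtTh2009, Def 3.3 p.299 (PDF p.73)] -/
theorem realifiedGenuine_BΛ_map_injective {Y Y' : (Discrete PUnit.{1})ᵒᵖ} (g : Y ⟶ Y') :
    Function.Injective (realifiedGenuine.BΛ.map g).hom :=
  fun _ _ h => h

/-- **`hinj` at the toy data**: `B₀^Λ(Y) → (Φ₀^ℝ)^gp(Y)`, `𝔭^m ↦ ι(𝔭)^m`, is injective — `ι(𝔭) ≠ 1` in the sharp,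
cancellative realification `ℕ^rlf`, so `ι(𝔭)` has infinite order in `(ℕ^rlf)^gp`. [cite: MochizukiEtTh2009, Def 3.6 p.302 (PDF p.76)] -/
theorem realifiedGenuine_divΛ_injective (Y : (Discrete PUnit.{1})ᵒᵖ) :
    Function.Injective (realifiedGenuine.divΛ Y) := by
  -- typed names: `ι : ℕ → ℕ^pf → ℕ^rlf`, and `B₀^Λ(Y) → (Φ₀^ℝ)^gp(Y)` is `ι^gp ∘ (m ↦ 𝔭^m)` by construction (`ofRlfZ`)
  let ι : Multiplicative ℕ →* (isPerfFactorial_Φ₀ Y).Rlf :=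
    (isPerfFactorial_Φ₀ Y).toRealification.comp (Perfection.of _)
  suffices h : Function.Injective ((EtaleTheta.gpMap ι).comp divHom) from h
  haveI : IsCancelMul (isPerfFactorial_Φ₀ Y).Rlf := IsPerfFactorial.Rlf.isCancelMul _
  have ht1 : ι (Multiplicative.ofAdd (1 : ℕ)) ≠ 1 := toRealification_of_ofAdd_one_ne_one Y
  have hord : ¬ IsOfFinOrder (Algebra.GrothendieckGroup.of (ι (Multiplicative.ofAdd (1 : ℕ)))) := by
    intro hfin
    obtain ⟨n, hn, hgn⟩ := hfin.exists_pow_eq_one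
    rw [← map_pow] at hgn
    have htn := Algebra.GrothendieckGroup.of_injective (hgn.trans (map_one _).symm)
    exact ht1 ((IsPerfFactorial.Rlf.isSharp (isPerfFactorial_Φ₀ Y)).1 _ (IsUnit.of_pow_eq_one htn hn.ne'))
  intro a b hab
  simp only [MonoidHom.comp_apply, divHom, zpowersHom_apply, map_zpow, EtaleTheta.gpMap_of] at hab
  exact Multiplicative.toAdd.injective (injective_zpow_iff_not_isOfFinOrder.mpr hord hab)

/-- **`hBmon` at the re-based toy is a THEOREM**: `B` is a monoid on `B^temp(Π)⁰` ([FrdI] Def. 1.1 (ii); `hBinj` above,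
`hFSM` = [FrdII] Ex. 1.3 (i)). [cite: MochizukiEtTh2009, Def 3.6 p.303 (PDF p.77)] -/
theorem isMonoidOn_ratFnFunctor_genuineTemperedFrobenioidConnectedPart :
    IsMonoidOn (genuineTemperedFrobenioidConnectedPart Γ R S).ratFnFunctor :=
  (genuineTemperedFrobenioidConnectedPart Γ R S).isMonoidOn_ratFnFunctor
    (fun g => realifiedGenuine_BΛ_map_injective g)
    fun α hα => QuasiTemperoid.BTempConnected.connectedPart_isOfFSMType.isIso_of_isFSM α hα

/-- **The re-based toy IS a Frobenioid** ([FrdI] Def. 1.3 via Thm. 5.2 (ii)), unconditionally.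
[cite: MochizukiEtTh2009, Def 3.6 p.303 (PDF p.77)] -/
theorem isFrobenioid_genuineTemperedFrobenioidConnectedPart :
    PreFrobenioid.IsFrobenioid (genuineTemperedFrobenioidConnectedPart Γ R S).toElem :=
  (genuineTemperedFrobenioidConnectedPart Γ R S).isFrobenioid_treeCatVocab_of_isMonoidOn
    (isMonoidOn_ratFnFunctor_genuineTemperedFrobenioidConnectedPart Γ R S)

/-- **Thm. 3.7 (iv) (named `Prop` `Thm37_iv`) holds for the re-based toy**, unconditionally (`hdiv` from unit-triviality,
`hinj` above). [cite: MochizukiEtTh2009, Thm 3.7 p.306 (PDF p.80)] -/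
theorem thm37_iv_genuineTemperedFrobenioidConnectedPart :
    (genuineTemperedFrobenioidConnectedPart Γ R S).Thm37_iv :=
  (genuineTemperedFrobenioidConnectedPart Γ R S).thm37_iv_of_divΛ_injective
    (isFrobenioid_genuineTemperedFrobenioidConnectedPart Γ R S) fun _ => realifiedGenuine_divΛ_injective _

variable [IsTopologicalGroup Γ]

/-- **The CONCLUSION of Thm. 3.7 (iv), «`C` is slim», for a CONSTRUCTED tempered Frobenioid over the genuine base
`B^temp(Π)⁰` of a tempered, temp-slim group `Π`** — every binder of `Sec3Thm37ivGenuineBase` discharged at this datum.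
[cite: MochizukiEtTh2009, Thm 3.7 p.306 (PDF p.80)] -/
theorem isSlim_genuineTemperedFrobenioidConnectedPart (hG : IsTempered Γ) (hZ : IsSlimGroup Γ) :
    IsSlim (genuineTemperedFrobenioidConnectedPart Γ R S).category :=
  (genuineTemperedFrobenioidConnectedPart Γ R S).isSlim_category_of_divΛ_injective
    (isFrobenioid_genuineTemperedFrobenioidConnectedPart Γ R S) (fun _ => realifiedGenuine_divΛ_injective _)
    (isSlim_connectedPart_bTemp hG hZ)

end Toy

/-! ### §4′ The smallest genuine instance: `Π = 1` (tempered: countable discrete; temp-slim: trivially) -/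

namespace Toy

variable (R S : ((ConnectedPart (BTemp PUnit.{u' + 1}))ᵒᵖ ⥤ CommMonCat.{0}) → Prop)

/-- The trivial group is temp-slim. [cite: MochizukiSemiAnbd2006, Rmk 3.4.1 p.36] -/
theorem isSlimGroup_punit : IsSlimGroup PUnit.{u' + 1} := ⟨fun _ _ => Subsingleton.elim _ _⟩

/-- **«`C` is slim» for the constructed tempered Frobenioid over `B^temp(1)⁰`** — a closed, hypothesis-free instance
of the conclusion of [EtTh] Thm. 3.7 (iv) over a genuine connected-temperoid base. [cite: MochizukiEtTh2009, Thm 3.7 p.306 (PDF p.80)] -/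
theorem isSlim_genuineTemperedFrobenioidConnectedPart_punit :
    IsSlim (genuineTemperedFrobenioidConnectedPart PUnit.{u' + 1} R S).category :=
  isSlim_genuineTemperedFrobenioidConnectedPart PUnit.{u' + 1} R S isTempered_of_discreteTopology
    isSlimGroup_punit

end Toy

end Literature.AnabelianGeometry.EtaleTheta
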